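import Mathlib
import Literature.Analysis.FluidPDE.SuitableWeak
import Literature.Analysis.FluidPDE.Seregin2023.TypeIIEulerZoom
import Literature.Analysis.FluidPDE.LerayHopfProofs
import Summits.NavierStokesRegularity.NavierStokesRegularity.Theorems.EulerZoomLiouvillePowerGaugeEulerLiouvilleWindowCubic
import HarnessLib

/-!
# Window flux BOUNDS on one ball from the gauges (crux `EulerZoomLiouville.PowerGaugeEulerLiouville`,
# lead's line `birth`, successor target #1 — second half, part 1)

Route `EulerZoomLiouville` (NavierStokesRegularity), crux E = stmt-NavierStokesRegularity-19832
`PowerGaugeEulerLiouville`.  For the window flux integrability (`…WindowFlux.lean`) one needs, on every ball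
`B_a` and window `(α,β)` with `−a² ≤ α < β ≤ 0`, a power bound for `∫∫ (|u|³ + 2|p||u|)`:

* `lintegral_pressure_velocity_window_le` — Hölder with the `D`-gauge:
  `∫∫_{(α,β)×B_a} |p||u| ≤ (c a^{2−2ρ})^{2/3} (∫∫_{(α,β)×B_a}|u|³)^{1/3}`;
* `exists_lintegral_cube_window_ball_le_rpow` — the window cubic bound in power form
  `∫∫_{(α,β)×B_a} |u|³ ≤ K c^{3/2}(L^{1/4}+L) a^{3/2−9ρ/4}` (`a ≥ 1`, `L = β−α`, from
  `exists_lintegral_cube_window_ball_le`);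
* `exists_lintegral_cube_add_pressure_window_le` — together:
  `∫∫_{(α,β)×B_a} (|u|³ + 2|p||u|) ≤ K₃ a^{3/2−9ρ/4} + 2c^{2/3}K₃^{1/3} a^{11/6−25ρ/12}`,
  `K₃ = K c^{3/2}(L^{1/4}+L)`.

WHAT THIS IS NOT: not NS — bookkeeping toward «no Euler collapse from rest» for `2/5 < ρ`. [folklore]
-/

noncomputable section

set_option linter.dupNamespace false

open MeasureTheory Set Filter Topology Metric Function TopologicalSpace Module
open scoped ENNReal NNReal

namespace Summit.NavierStokesRegularity.NavierStokesRegularity.Theorems.PowerGaugeEulerLiouville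

open Literature.Analysis Literature.Analysis.FunctionSpaces Literature.Analysis.FluidPDE

/-! ## The pressure × velocity window bound (Hölder with the `D`-gauge) -/

/-- **Pressure–velocity window bound.**  For `−a² ≤ α < β ≤ 0`, `a > 0`:
`∫∫_{(α,β)×B_a} |p| |u| ≤ (∫∫_{Q_a} |p|^{3/2})^{2/3} (∫∫_{(α,β)×B_a} |u|³)^{1/3}` and
`∫∫_{Q_a} |p|^{3/2} = a² D(a)`, so with the `D`-gauge `a^{2ρ} D(a) ≤ c`:
`∫∫_{(α,β)×B_a} |p| |u| ≤ (c a^{2−2ρ})^{2/3} (∫∫_{(α,β)×B_a} |u|³)^{1/3}`. [folklore] -/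
theorem lintegral_pressure_velocity_window_le {ρ : ℝ}
    {u : ℝ → EuclideanSpace ℝ (Fin 3) → EuclideanSpace ℝ (Fin 3)} {p : ℝ → EuclideanSpace ℝ (Fin 3) → ℝ}
    {c : ℝ≥0}
    (hum : AEStronglyMeasurable (uncurry u) (volume.restrict (Iio (0 : ℝ) ×ˢ (univ : Set (EuclideanSpace ℝ (Fin 3))))))
    (hpm : AEStronglyMeasurable (uncurry p) (volume.restrict (Iio (0 : ℝ) ×ˢ (univ : Set (EuclideanSpace ℝ (Fin 3))))))
    (hD : ∀ a : ℝ, 0 < a → ENNReal.ofReal (a ^ (2 * ρ)) * cknD a (0 : ℝ × EuclideanSpace ℝ (Fin 3)) p ≤ (c : ℝ≥0∞))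
    {a α β : ℝ} (ha : 0 < a) (hα : -(a ^ 2) ≤ α) (hβ : β ≤ 0) :
    ∫⁻ z in Ioo α β ×ˢ ball (0 : EuclideanSpace ℝ (Fin 3)) a, ‖p z.1 z.2‖ₑ * ‖u z.1 z.2‖ₑ ≤
      ENNReal.ofReal (c * a ^ (2 - 2 * ρ)) ^ (2 / 3 : ℝ) *
        (∫⁻ z in Ioo α β ×ˢ ball (0 : EuclideanSpace ℝ (Fin 3)) a, ‖u z.1 z.2‖ₑ ^ (3 : ℕ)) ^ (1 / 3 : ℝ) := by
  set S : Set (ℝ × EuclideanSpace ℝ (Fin 3)) := Ioo α β ×ˢ ball (0 : EuclideanSpace ℝ (Fin 3)) a with hS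
  have hSsub : S ⊆ Iio (0 : ℝ) ×ˢ (univ : Set (EuclideanSpace ℝ (Fin 3))) :=
    prod_mono (fun s hs => lt_of_lt_of_le hs.2 hβ) (subset_univ _)
  have hSQ : S ⊆ parabolicCylinder a (0 : ℝ × EuclideanSpace ℝ (Fin 3)) := by
    intro z hz
    simp only [parabolicCylinder, mem_prod, mem_Ioo, mem_ball, Prod.fst_zero, Prod.snd_zero, zero_sub] at hz ⊢
    exact ⟨⟨lt_of_le_of_lt hα hz.1.1, lt_of_lt_of_le hz.1.2 hβ⟩, mem_ball.1 hz.2⟩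
  have hu' : AEMeasurable (fun z : ℝ × EuclideanSpace ℝ (Fin 3) => ‖u z.1 z.2‖ₑ) (volume.restrict S) :=
    (hum.mono_measure (Measure.restrict_mono hSsub le_rfl)).aemeasurable.enorm
  have hp' : AEMeasurable (fun z : ℝ × EuclideanSpace ℝ (Fin 3) => ‖p z.1 z.2‖ₑ) (volume.restrict S) :=
    (hpm.mono_measure (Measure.restrict_mono hSsub le_rfl)).aemeasurable.enorm
  have hpq : (3 / 2 : ℝ).HolderConjugate 3 := Real.holderConjugate_iff.2 ⟨by norm_num, by norm_num⟩
  have hH := ENNReal.lintegral_mul_le_Lp_mul_Lq (volume.restrict S) hpq hp' hu'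
  simp only [Pi.mul_apply] at hH
  refine hH.trans ?_
  have e3 : ∀ z : ℝ × EuclideanSpace ℝ (Fin 3), ‖u z.1 z.2‖ₑ ^ (3 : ℝ) = ‖u z.1 z.2‖ₑ ^ (3 : ℕ) := fun z => by
    rw [← ENNReal.rpow_natCast]; norm_num
  simp_rw [e3]
  rw [show (1 / (3 / 2 : ℝ)) = (2 / 3 : ℝ) by norm_num]
  refine mul_le_mul' (ENNReal.rpow_le_rpow ?_ (by norm_num)) le_rfl
  -- `∫_S |p|^{3/2} ≤ c a^{2-2ρ}`
  have h1 := hD a ha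
  have hJ : ∫⁻ q in parabolicCylinder a (0 : ℝ × EuclideanSpace ℝ (Fin 3)), ‖p q.1 q.2‖ₑ ^ (3 / 2 : ℝ) ≤
      ENNReal.ofReal (c * a ^ (2 - 2 * ρ)) := by
    have hpos : 0 < a ^ (2 * ρ) * (a ^ 2)⁻¹ := by positivity
    have hcoef : ENNReal.ofReal (a ^ (2 * ρ)) * (ENNReal.ofReal a ^ 2)⁻¹ = ENNReal.ofReal (a ^ (2 * ρ) * (a ^ 2)⁻¹) := by
      rw [← ENNReal.ofReal_pow ha.le, ← ENNReal.ofReal_inv_of_pos (by positivity),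
        ← ENNReal.ofReal_mul (Real.rpow_nonneg ha.le _)]
    unfold cknD at h1
    rw [← mul_assoc, hcoef] at h1
    have h2 : ∫⁻ q in parabolicCylinder a (0 : ℝ × EuclideanSpace ℝ (Fin 3)), ‖p q.1 q.2‖ₑ ^ (3 / 2 : ℝ) ≤
        (c : ℝ≥0∞) / ENNReal.ofReal (a ^ (2 * ρ) * (a ^ 2)⁻¹) := by
      rw [ENNReal.le_div_iff_mul_le (Or.inl ((ENNReal.ofReal_pos.2 hpos).ne')) (Or.inl ENNReal.ofReal_ne_top),
        mul_comm]
      exact h1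
    refine h2.trans (le_of_eq ?_)
    rw [ENNReal.coe_nnreal_eq, ← ENNReal.ofReal_div_of_pos hpos]
    congr 1
    rw [div_eq_mul_inv, mul_inv, inv_inv, Real.rpow_sub ha, Real.rpow_two, div_eq_mul_inv]
    ring
  exact (lintegral_mono_set hSQ).trans hJ

/-! ## The window cubic bound in power form -/

/-- **Window cubic bound, power form.**  Absolute `K` with: for a member (`A`,`E` gauges), `0 ≤ ρ ≤ 2/3`,
`a ≥ 1`, `−a² ≤ α < β ≤ 0`, `L = β − α`:
`∫∫_{(α,β)×B_a} |u|³ ≤ K · c^{3/2} (L^{1/4} + L) · a^{3/2 − 9ρ/4}` (from `exists_lintegral_cube_window_ball_le`,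
`|B_a| = |B₁| a³`, and `a^{−3ρ} ≤ a^{3/2−9ρ/4}` for `a ≥ 1`). [folklore] -/
theorem exists_lintegral_cube_window_ball_le_rpow :
    ∃ K : ℝ, 0 ≤ K ∧ ∀ (ρ : ℝ), 0 ≤ ρ → ∀ (u : ℝ → EuclideanSpace ℝ (Fin 3) → EuclideanSpace ℝ (Fin 3))
      (H : ℝ → EuclideanSpace ℝ (Fin 3) → EuclideanSpace ℝ (Fin 3) →L[ℝ] EuclideanSpace ℝ (Fin 3)) (c : ℝ≥0),
      HasWeakSpatialGradientOn (slab (EuclideanSpace ℝ (Fin 3)) (Iio 0) isOpen_Iio) u H →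
      (∀ a : ℝ, 0 < a → ENNReal.ofReal (a ^ (2 * ρ)) * cknA a (0 : ℝ × EuclideanSpace ℝ (Fin 3)) u ≤ (c : ℝ≥0∞)) →
      (∀ a : ℝ, 0 < a → ENNReal.ofReal (a ^ ρ) * cknE a (0 : ℝ × EuclideanSpace ℝ (Fin 3)) H ≤ (c : ℝ≥0∞)) →
      ∀ (a α β : ℝ), 1 ≤ a → -(a ^ 2) ≤ α → α < β → β ≤ 0 →
        ∫⁻ z in Ioo α β ×ˢ ball (0 : EuclideanSpace ℝ (Fin 3)) a, ‖u z.1 z.2‖ₑ ^ (3 : ℕ) ≤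
          ENNReal.ofReal (K * (c : ℝ) ^ (3 / 2 : ℝ) * ((β - α) ^ (1 / 4 : ℝ) + (β - α)) * a ^ (3 / 2 - 9 * ρ / 4)) := by
  obtain ⟨K, hKtop, hK⟩ := exists_lintegral_cube_window_ball_le
  set V₁ : ℝ≥0∞ := volume (ball (0 : EuclideanSpace ℝ (Fin 3)) 1) with hV₁
  have hV₁0 : V₁ ≠ 0 := (measure_ball_pos volume _ one_pos).ne'
  have hV₁top : V₁ ≠ ⊤ := measure_ball_lt_top.ne
  -- the real constant: `K.toReal * max 1 (V₁^{-1/2}).toReal`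
  set W₁ : ℝ := (V₁⁻¹ ^ (1 / 2 : ℝ)).toReal with hW₁
  have hW₁0 : 0 ≤ W₁ := ENNReal.toReal_nonneg
  refine ⟨K.toReal * (1 + W₁), by positivity, ?_⟩
  intro ρ hρ u H c hH hA hE a α β ha hα hαβ hβ
  have ha0 : 0 < a := lt_of_lt_of_le one_pos ha
  have hL : 0 < β - α := by linarith
  have h1 := hK ρ u H c hH hA hE a α β ha0 hα hαβ hβ
  refine h1.trans ?_
  -- rewrite every `ℝ≥0∞` factor as `ofReal` of a nonnegative real
  have hc0 : 0 ≤ (c : ℝ) := c.2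
  have eA : ENNReal.ofReal (c * a ^ (1 - 2 * ρ)) ^ (3 / 4 : ℝ) = ENNReal.ofReal ((c * a ^ (1 - 2 * ρ)) ^ (3 / 4 : ℝ)) :=
    ENNReal.ofReal_rpow_of_nonneg (by positivity) (by norm_num)
  have eE : ENNReal.ofReal (c * a ^ (1 - ρ)) ^ (3 / 4 : ℝ) = ENNReal.ofReal ((c * a ^ (1 - ρ)) ^ (3 / 4 : ℝ)) :=
    ENNReal.ofReal_rpow_of_nonneg (by positivity) (by norm_num)
  have eL : ENNReal.ofReal (β - α) ^ (1 / 4 : ℝ) = ENNReal.ofReal ((β - α) ^ (1 / 4 : ℝ)) :=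
    ENNReal.ofReal_rpow_of_nonneg hL.le (by norm_num)
  have eA2 : ENNReal.ofReal (c * a ^ (1 - 2 * ρ)) ^ (3 / 2 : ℝ) = ENNReal.ofReal ((c * a ^ (1 - 2 * ρ)) ^ (3 / 2 : ℝ)) :=
    ENNReal.ofReal_rpow_of_nonneg (by positivity) (by norm_num)
  have eV : (volume (ball (0 : EuclideanSpace ℝ (Fin 3)) a))⁻¹ ^ (1 / 2 : ℝ) =
      V₁⁻¹ ^ (1 / 2 : ℝ) * ENNReal.ofReal (a ^ (-(3 / 2 : ℝ))) := by
    rw [Measure.addHaar_ball_of_pos volume _ ha0, finrank_euclideanSpace_fin, ← hV₁, ENNReal.mul_inv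
      (Or.inr hV₁top) (Or.inr hV₁0), ENNReal.mul_rpow_of_nonneg _ _ (by norm_num), mul_comm]
    congr 1
    rw [← ENNReal.ofReal_inv_of_pos (by positivity),
      ENNReal.ofReal_rpow_of_nonneg (by positivity) (by norm_num)]
    congr 1
    rw [← Real.rpow_natCast, ← Real.rpow_neg ha0.le, ← Real.rpow_mul ha0.le]
    norm_num
  have hKr : K = ENNReal.ofReal K.toReal := (ENNReal.ofReal_toReal hKtop).symm
  have hWr : V₁⁻¹ ^ (1 / 2 : ℝ) = ENNReal.ofReal W₁ := by
    rw [hW₁, ENNReal.ofReal_toReal (ENNReal.rpow_ne_top_of_nonneg (by norm_num) (ENNReal.inv_ne_top.2 hV₁0))]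
  rw [eA, eE, eL, eA2, eV, hKr, hWr]
  -- now everything is `ofReal`; compute in `ℝ`
  have key : ∀ x y z w v t : ℝ, 0 ≤ x → 0 ≤ y → 0 ≤ z → 0 ≤ w → 0 ≤ v → 0 ≤ t →
      ENNReal.ofReal x * (ENNReal.ofReal y * ENNReal.ofReal z * ENNReal.ofReal w +
        ENNReal.ofReal v * (ENNReal.ofReal t * ENNReal.ofReal (a ^ (-(3 / 2 : ℝ)))) * ENNReal.ofReal (c * a ^ (1 - 2 * ρ)) ^ (0:ℕ) * ENNReal.ofReal ((c * a ^ (1 - 2 * ρ)) ^ (3 / 2 : ℝ))) =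
      ENNReal.ofReal (x * (y * z * w + v * (t * a ^ (-(3 / 2 : ℝ))) * (c * a ^ (1 - 2 * ρ)) ^ (3 / 2 : ℝ))) := by
    intro x y z w v t hx hy hz hw hv ht
    rw [pow_zero, mul_one, ← ENNReal.ofReal_mul hy, ← ENNReal.ofReal_mul (by positivity),
      ← ENNReal.ofReal_mul ht, ← ENNReal.ofReal_mul hv, ← ENNReal.ofReal_mul (by positivity),
      ← ENNReal.ofReal_add (by positivity) (by positivity), ← ENNReal.ofReal_mul hx]
  have := key K.toReal ((c * a ^ (1 - 2 * ρ)) ^ (3 / 4 : ℝ)) ((c * a ^ (1 - ρ)) ^ (3 / 4 : ℝ)) ((β - α) ^ (1 / 4 : ℝ))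
    (β - α) W₁ ENNReal.toReal_nonneg (by positivity) (by positivity) (by positivity) hL.le hW₁0
  rw [pow_zero, mul_one] at this
  rw [this, ENNReal.toReal_ofReal (ENNReal.toReal_nonneg)]
  refine ENNReal.ofReal_le_ofReal ?_
  -- the real inequality
  have hcpow : (c : ℝ) ^ (3 / 2 : ℝ) = ((c : ℝ) ^ (3 / 4 : ℝ)) * ((c : ℝ) ^ (3 / 4 : ℝ)) := by
    rw [← Real.rpow_add' hc0 (by norm_num)]; norm_num
  have t1 : (c * a ^ (1 - 2 * ρ)) ^ (3 / 4 : ℝ) * (c * a ^ (1 - ρ)) ^ (3 / 4 : ℝ) =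
      (c : ℝ) ^ (3 / 2 : ℝ) * a ^ (3 / 2 - 9 * ρ / 4) := by
    rw [Real.mul_rpow hc0 (Real.rpow_nonneg ha0.le _), Real.mul_rpow hc0 (Real.rpow_nonneg ha0.le _),
      ← Real.rpow_mul ha0.le, ← Real.rpow_mul ha0.le, hcpow]
    rw [show (c : ℝ) ^ (3 / 4 : ℝ) * a ^ ((1 - 2 * ρ) * (3 / 4)) * ((c : ℝ) ^ (3 / 4 : ℝ) * a ^ ((1 - ρ) * (3 / 4))) =
      (c : ℝ) ^ (3 / 4 : ℝ) * (c : ℝ) ^ (3 / 4 : ℝ) * (a ^ ((1 - 2 * ρ) * (3 / 4)) * a ^ ((1 - ρ) * (3 / 4))) by ring,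
      ← Real.rpow_add ha0]
    congr 1; ring_nf
  have t2 : a ^ (-(3 / 2 : ℝ)) * (c * a ^ (1 - 2 * ρ)) ^ (3 / 2 : ℝ) = (c : ℝ) ^ (3 / 2 : ℝ) * a ^ (-(3 * ρ)) := by
    rw [Real.mul_rpow hc0 (Real.rpow_nonneg ha0.le _), ← Real.rpow_mul ha0.le]
    rw [show a ^ (-(3 / 2 : ℝ)) * ((c : ℝ) ^ (3 / 2 : ℝ) * a ^ ((1 - 2 * ρ) * (3 / 2))) =
      (c : ℝ) ^ (3 / 2 : ℝ) * (a ^ (-(3 / 2 : ℝ)) * a ^ ((1 - 2 * ρ) * (3 / 2))) by ring, ← Real.rpow_add ha0]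
    congr 1; ring_nf
  have t3 : a ^ (-(3 * ρ)) ≤ a ^ (3 / 2 - 9 * ρ / 4) :=
    Real.rpow_le_rpow_of_exponent_le ha (by linarith)
  have hpos1 : 0 ≤ (c : ℝ) ^ (3 / 2 : ℝ) * a ^ (3 / 2 - 9 * ρ / 4) := by positivity
  calc K.toReal * ((c * a ^ (1 - 2 * ρ)) ^ (3 / 4 : ℝ) * (c * a ^ (1 - ρ)) ^ (3 / 4 : ℝ) * (β - α) ^ (1 / 4 : ℝ) +
        (β - α) * (W₁ * a ^ (-(3 / 2 : ℝ))) * (c * a ^ (1 - 2 * ρ)) ^ (3 / 2 : ℝ))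
      = K.toReal * ((c : ℝ) ^ (3 / 2 : ℝ) * a ^ (3 / 2 - 9 * ρ / 4) * (β - α) ^ (1 / 4 : ℝ) +
          (β - α) * W₁ * ((c : ℝ) ^ (3 / 2 : ℝ) * a ^ (-(3 * ρ)))) := by
        rw [t1, ← t2]; ring
    _ ≤ K.toReal * ((c : ℝ) ^ (3 / 2 : ℝ) * a ^ (3 / 2 - 9 * ρ / 4) * (β - α) ^ (1 / 4 : ℝ) +
          (β - α) * W₁ * ((c : ℝ) ^ (3 / 2 : ℝ) * a ^ (3 / 2 - 9 * ρ / 4))) := by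
        gcongr
    _ = K.toReal * ((c : ℝ) ^ (3 / 2 : ℝ) * a ^ (3 / 2 - 9 * ρ / 4)) *
          ((β - α) ^ (1 / 4 : ℝ) + W₁ * (β - α)) := by ring
    _ ≤ K.toReal * ((c : ℝ) ^ (3 / 2 : ℝ) * a ^ (3 / 2 - 9 * ρ / 4)) *
          ((1 + W₁) * ((β - α) ^ (1 / 4 : ℝ) + (β - α))) := by
        have hK0 : 0 ≤ K.toReal := ENNReal.toReal_nonneg
        have hL4 : 0 ≤ (β - α) ^ (1 / 4 : ℝ) := by positivity
        refine mul_le_mul_of_nonneg_left ?_ (mul_nonneg hK0 hpos1)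
        nlinarith [mul_nonneg hW₁0 hL4, hL.le]
    _ = K.toReal * (1 + W₁) * (c : ℝ) ^ (3 / 2 : ℝ) * ((β - α) ^ (1 / 4 : ℝ) + (β - α)) * a ^ (3 / 2 - 9 * ρ / 4) := by
        ring

/-! ## The combined window bound on one ball: `∫∫ (|u|³ + 2|p||u|) ≤ K₃ a^s + K₄ a^t` -/

/-- **Cubic + pressure flux mass on one ball and one window, power form.**  For a member of the class
(`A`,`E`,`D` gauges; `0 ≤ ρ`), `a ≥ 1`, `−a² ≤ α < β ≤ 0`, `L = β − α`, with the absolute `K` of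
`exists_lintegral_cube_window_ball_le_rpow` and `K₃ = K c^{3/2}(L^{1/4} + L)`:
`∫∫_{(α,β)×B_a} (|u|³ + 2|p||u|) ≤ K₃ a^{3/2−9ρ/4} + 2 c^{2/3} K₃^{1/3} a^{11/6 − 25ρ/12}`. [folklore] -/
theorem exists_lintegral_cube_add_pressure_window_le :
    ∃ K : ℝ, 0 ≤ K ∧ ∀ (ρ : ℝ), 0 ≤ ρ → ∀ (u : ℝ → EuclideanSpace ℝ (Fin 3) → EuclideanSpace ℝ (Fin 3))
      (p : ℝ → EuclideanSpace ℝ (Fin 3) → ℝ)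
      (H : ℝ → EuclideanSpace ℝ (Fin 3) → EuclideanSpace ℝ (Fin 3) →L[ℝ] EuclideanSpace ℝ (Fin 3)) (c : ℝ≥0),
      IsSuitableWeakSolutionOn (slab (EuclideanSpace ℝ (Fin 3)) (Iio 0) isOpen_Iio) 0 0 u p →
      HasWeakSpatialGradientOn (slab (EuclideanSpace ℝ (Fin 3)) (Iio 0) isOpen_Iio) u H →
      (∀ a : ℝ, 0 < a → ENNReal.ofReal (a ^ (2 * ρ)) * cknA a (0 : ℝ × EuclideanSpace ℝ (Fin 3)) u +
        ENNReal.ofReal (a ^ ρ) * cknE a (0 : ℝ × EuclideanSpace ℝ (Fin 3)) H +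
        ENNReal.ofReal (a ^ (2 * ρ)) * cknD a (0 : ℝ × EuclideanSpace ℝ (Fin 3)) p ≤ (c : ℝ≥0∞)) →
      ∀ (a α β : ℝ), 1 ≤ a → -(a ^ 2) ≤ α → α < β → β ≤ 0 →
        ∫⁻ z in Ioo α β ×ˢ ball (0 : EuclideanSpace ℝ (Fin 3)) a,
            (‖u z.1 z.2‖ₑ ^ (3 : ℕ) + 2 * (‖p z.1 z.2‖ₑ * ‖u z.1 z.2‖ₑ)) ≤
          ENNReal.ofReal (K * (c : ℝ) ^ (3 / 2 : ℝ) * ((β - α) ^ (1 / 4 : ℝ) + (β - α)) * a ^ (3 / 2 - 9 * ρ / 4) +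
            2 * ((c : ℝ) ^ (2 / 3 : ℝ) * (K * (c : ℝ) ^ (3 / 2 : ℝ) * ((β - α) ^ (1 / 4 : ℝ) + (β - α))) ^ (1 / 3 : ℝ)) *
              a ^ (11 / 6 - 25 * ρ / 12)) := by
  obtain ⟨K, hK0, hK⟩ := exists_lintegral_cube_window_ball_le_rpow
  refine ⟨K, hK0, fun ρ hρ u p H c hsw hH hc a α β ha hα hαβ hβ => ?_⟩
  have ha0 : 0 < a := lt_of_lt_of_le one_pos ha
  have hL : 0 < β - α := by linarith
  have hc0 : 0 ≤ (c : ℝ) := c.2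
  have hA : ∀ a : ℝ, 0 < a →
      ENNReal.ofReal (a ^ (2 * ρ)) * cknA a (0 : ℝ × EuclideanSpace ℝ (Fin 3)) u ≤ (c : ℝ≥0∞) :=
    fun a ha => le_trans (le_trans le_self_add le_self_add) (hc a ha)
  have hE : ∀ a : ℝ, 0 < a →
      ENNReal.ofReal (a ^ ρ) * cknE a (0 : ℝ × EuclideanSpace ℝ (Fin 3)) H ≤ (c : ℝ≥0∞) :=
    fun a ha => le_trans (le_trans le_add_self le_self_add) (hc a ha)
  have hD : ∀ a : ℝ, 0 < a →
      ENNReal.ofReal (a ^ (2 * ρ)) * cknD a (0 : ℝ × EuclideanSpace ℝ (Fin 3)) p ≤ (c : ℝ≥0∞) :=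
    fun a ha => le_trans le_add_self (hc a ha)
  have hum : AEStronglyMeasurable (uncurry u)
      (volume.restrict (Iio (0 : ℝ) ×ˢ (univ : Set (EuclideanSpace ℝ (Fin 3))))) := by
    have := hH.locallyIntegrableOn.aestronglyMeasurable
    simpa [slab] using this
  have hpm : AEStronglyMeasurable (uncurry p)
      (volume.restrict (Iio (0 : ℝ) ×ˢ (univ : Set (EuclideanSpace ℝ (Fin 3))))) := by
    have := hsw.distributional.2.2.1.aestronglyMeasurable
    simpa [slab] using this
  set K₃ : ℝ := K * (c : ℝ) ^ (3 / 2 : ℝ) * ((β - α) ^ (1 / 4 : ℝ) + (β - α)) with hK₃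
  have hK₃0 : 0 ≤ K₃ := by positivity
  have hI := hK ρ hρ u H c hH hA hE a α β ha hα hαβ hβ
  have hP := lintegral_pressure_velocity_window_le hum hpm hD ha0 hα hβ
  -- measurability for splitting the integral
  set S : Set (ℝ × EuclideanSpace ℝ (Fin 3)) := Ioo α β ×ˢ ball (0 : EuclideanSpace ℝ (Fin 3)) a with hS
  have hSsub : S ⊆ Iio (0 : ℝ) ×ˢ (univ : Set (EuclideanSpace ℝ (Fin 3))) :=
    prod_mono (fun s hs => lt_of_lt_of_le hs.2 hβ) (subset_univ _)
  have hu' : AEMeasurable (fun z : ℝ × EuclideanSpace ℝ (Fin 3) => ‖u z.1 z.2‖ₑ) (volume.restrict S) :=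
    (hum.mono_measure (Measure.restrict_mono hSsub le_rfl)).aemeasurable.enorm
  have hp' : AEMeasurable (fun z : ℝ × EuclideanSpace ℝ (Fin 3) => ‖p z.1 z.2‖ₑ) (volume.restrict S) :=
    (hpm.mono_measure (Measure.restrict_mono hSsub le_rfl)).aemeasurable.enorm
  rw [lintegral_add_left' (hu'.pow_const 3),
    lintegral_const_mul'' _ (show AEMeasurable (fun z : ℝ × EuclideanSpace ℝ (Fin 3) => ‖p z.1 z.2‖ₑ * ‖u z.1 z.2‖ₑ) (volume.restrict S) from hp'.mul hu')]
  -- the two pieces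
  have h1 : ∫⁻ z in S, ‖u z.1 z.2‖ₑ ^ (3 : ℕ) ≤ ENNReal.ofReal (K₃ * a ^ (3 / 2 - 9 * ρ / 4)) := hI
  have h2 : ∫⁻ z in S, ‖p z.1 z.2‖ₑ * ‖u z.1 z.2‖ₑ ≤
      ENNReal.ofReal ((c : ℝ) ^ (2 / 3 : ℝ) * K₃ ^ (1 / 3 : ℝ) * a ^ (11 / 6 - 25 * ρ / 12)) := by
    refine hP.trans ?_
    have e1 : ENNReal.ofReal (c * a ^ (2 - 2 * ρ)) ^ (2 / 3 : ℝ) = ENNReal.ofReal ((c * a ^ (2 - 2 * ρ)) ^ (2 / 3 : ℝ)) :=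
      ENNReal.ofReal_rpow_of_nonneg (by positivity) (by norm_num)
    have e2 : (∫⁻ z in S, ‖u z.1 z.2‖ₑ ^ (3 : ℕ)) ^ (1 / 3 : ℝ) ≤
        ENNReal.ofReal ((K₃ * a ^ (3 / 2 - 9 * ρ / 4)) ^ (1 / 3 : ℝ)) := by
      rw [← ENNReal.ofReal_rpow_of_nonneg (by positivity) (by norm_num)]
      exact ENNReal.rpow_le_rpow h1 (by norm_num)
    rw [e1]
    refine (mul_le_mul' le_rfl e2).trans (le_of_eq ?_)
    rw [← ENNReal.ofReal_mul (by positivity)]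
    congr 1
    rw [Real.mul_rpow hc0 (Real.rpow_nonneg ha0.le _), Real.mul_rpow hK₃0 (Real.rpow_nonneg ha0.le _),
      ← Real.rpow_mul ha0.le, ← Real.rpow_mul ha0.le]
    rw [show (c : ℝ) ^ (2 / 3 : ℝ) * a ^ ((2 - 2 * ρ) * (2 / 3)) * (K₃ ^ (1 / 3 : ℝ) * a ^ ((3 / 2 - 9 * ρ / 4) * (1 / 3))) =
      (c : ℝ) ^ (2 / 3 : ℝ) * K₃ ^ (1 / 3 : ℝ) * (a ^ ((2 - 2 * ρ) * (2 / 3)) * a ^ ((3 / 2 - 9 * ρ / 4) * (1 / 3))) by ring,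
      ← Real.rpow_add ha0]
    congr 1; ring_nf
  calc (∫⁻ z in S, ‖u z.1 z.2‖ₑ ^ (3 : ℕ)) + 2 * ∫⁻ z in S, ‖p z.1 z.2‖ₑ * ‖u z.1 z.2‖ₑ
      ≤ ENNReal.ofReal (K₃ * a ^ (3 / 2 - 9 * ρ / 4)) +
          2 * ENNReal.ofReal ((c : ℝ) ^ (2 / 3 : ℝ) * K₃ ^ (1 / 3 : ℝ) * a ^ (11 / 6 - 25 * ρ / 12)) := add_le_add h1 (by gcongr)
    _ = ENNReal.ofReal (K₃ * a ^ (3 / 2 - 9 * ρ / 4) +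
          2 * ((c : ℝ) ^ (2 / 3 : ℝ) * K₃ ^ (1 / 3 : ℝ)) * a ^ (11 / 6 - 25 * ρ / 12)) := by
        rw [show (2 : ℝ≥0∞) = ENNReal.ofReal 2 by simp, ← ENNReal.ofReal_mul (by norm_num),
          ← ENNReal.ofReal_add (by positivity) (by positivity)]
        congr 1; ring

end Summit.NavierStokesRegularity.NavierStokesRegularity.Theorems.PowerGaugeEulerLiouville

end
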